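import Literature.Analysis.FluidPDE.RestrictedEulerDynamics
import HarnessLib

/-!
# The inviscid pure-strain germ of the odd cell IS restricted Euler in the rescaled variable `(5/7)·S`
(Negative lane bookkeeping, supports `RungBlowupCofinal` / BC5 rung 2 «HalfTurn»; circuit seat g9; companion of
`OddCellCentrePrimitives.lean`, `InviscidCentreLawBreakdown.lean`)

MODEL, NOT NS.  With no centre swirl (`β(0) = 0`) and `ν = 0`, the odd-cell centre law
(`OddCellCentrePrimitives`: the `[A·A]` channel is local) reads, for the centre strain `S = 3𝒜(0) ∈ Sym₀(3)`,

  `Ṡ = −(5/7) · (S² − ⅓ tr(S²) I)`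

— Vieillefosse's restricted Euler `Ṁ = −(M² − ⅓tr(M²)I)` with coefficient `κ₁ = 5/7` (halfturn.lean «germ rigidity»).  Since the
field is quadratic, `M := (5/7)·S` solves restricted Euler EXACTLY (`isRestrictedEulerSolutionOn_of_oddCellGerm`), so the whole
tree library `Literature/Analysis/FluidPDE/RestrictedEulerDynamics.lean` applies to the germ verbatim: invariants scale as
`Q((5/7)S) = (5/7)² Q(S)`, `R((5/7)S) = (5/7)³ R(S)`, `D((5/7)S) = (5/7)⁶ D(S)` (`invQ_smul`, `invR_smul`, `discr_smul`), and in
particular a TRIAXIAL inviscid pure-strain germ (three distinct strain eigenvalues, `D(S(0)) < 0` — the shape the half-turn rung's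
`IsTriaxial` letter asks of the limit germ) has FINITE LIFE with the library's explicit clock (`time_lt_of_triaxial_germ`).
Nothing here concerns `ν > 0` or asserts a Theses declaration.
-/

namespace Summit.NavierStokesRegularity.RungBlowupCofinalOddCellGerm

open Matrix Set Literature.Analysis.FluidPDE Literature.Analysis.FluidPDE.VelocityGradient
  Literature.Analysis.FluidPDE.RestrictedEuler

/-- `Q(c·A) = c² Q(A)`. -/
theorem invQ_smul (c : ℝ) (A : Matrix (Fin 3) (Fin 3) ℝ) : invQ (c • A) = c ^ 2 * invQ A := by
  rw [invQ_def, invQ_def, smul_mul_smul, trace_smul, smul_eq_mul]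
  ring

/-- `R(c·A) = c³ R(A)`. -/
theorem invR_smul (c : ℝ) (A : Matrix (Fin 3) (Fin 3) ℝ) : invR (c • A) = c ^ 3 * invR A := by
  simp only [invR_def, smul_mul_smul, trace_smul, smul_eq_mul]
  ring

/-- `D(c·A) = c⁶ D(A)` — the sign of the discriminant (real vs complex strain eigenvalues) is scale-invariant. -/
theorem discr_smul (c : ℝ) (A : Matrix (Fin 3) (Fin 3) ℝ) : discr (c • A) = c ^ 6 * discr A := by
  rw [discr_def, discr_def, invQ_smul, invR_smul]
  ring

/-- **The rescaled germ solves restricted Euler.**  If the centre strain obeys, entry by entry within the time set `s`,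
`Ṡ = −(5/7)(S² − (tr S²/3) I)`, then `t ↦ (5/7)·S(t)` is a restricted Euler solution on `s` (tree predicate
`IsRestrictedEulerSolutionOn`, field `−M² + (tr M²/3) I`). -/
theorem isRestrictedEulerSolutionOn_of_oddCellGerm {s : Set ℝ} {S : ℝ → Matrix (Fin 3) (Fin 3) ℝ}
    (h : ∀ t ∈ s, ∀ i j : Fin 3, HasDerivWithinAt (fun τ => S τ i j)
      ((-(5 / 7 : ℝ)) • (S t * S t - ((S t * S t).trace / 3) • (1 : Matrix (Fin 3) (Fin 3) ℝ)) i j) s t) :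
    IsRestrictedEulerSolutionOn s (fun t => (5 / 7 : ℝ) • S t) := by
  intro t ht i j
  have hd := (h t ht i j).const_mul (5 / 7 : ℝ)
  have hfun : (fun τ => (5 / 7 : ℝ) * S τ i j) = fun τ => ((5 / 7 : ℝ) • S τ) i j := by
    funext τ
    simp [Matrix.smul_apply]
  rw [hfun] at hd
  refine hd.congr_deriv ?_
  rw [field_def, smul_mul_smul, trace_smul, Fintype.card_fin]
  simp only [Matrix.smul_apply, Matrix.sub_apply, Matrix.add_apply, Matrix.neg_apply, smul_eq_mul,
    Matrix.one_apply]
  push_cast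
  split_ifs <;> ring

/-- **Finite life of a triaxial inviscid pure-strain germ.**  If the (trace-free) centre strain solves the odd-cell germ law on
`[0, T]` and has three distinct real eigenvalues at `t = 0` (`D(S(0)) < 0`), then `T` is bounded by the restricted-Euler clock of
the rescaled datum `M₀ = (5/7)S(0)`:
`T < max(0, (1 − 3R(M₀))/(2 min(1,|D(M₀)|)²)) + (1 + 2|D(M₀)|) + √6`. -/
theorem time_lt_of_triaxial_germ {T : ℝ} {S : ℝ → Matrix (Fin 3) (Fin 3) ℝ}
    (h : ∀ t ∈ Icc 0 T, ∀ i j : Fin 3, HasDerivWithinAt (fun τ => S τ i j)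
      ((-(5 / 7 : ℝ)) • (S t * S t - ((S t * S t).trace / 3) • (1 : Matrix (Fin 3) (Fin 3) ℝ)) i j) (Icc 0 T) t)
    (htr : (S 0).trace = 0) (hD : discr (S 0) < 0) :
    T < max 0 ((1 - 3 * invR ((5 / 7 : ℝ) • S 0)) / (2 * min 1 |discr ((5 / 7 : ℝ) • S 0)| ^ 2)) +
      (1 + 2 * |discr ((5 / 7 : ℝ) • S 0)|) + Real.sqrt 6 := by
  have hsol := isRestrictedEulerSolutionOn_of_oddCellGerm h
  have htr' : ((5 / 7 : ℝ) • S 0).trace = 0 := by rw [trace_smul, htr, smul_zero]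
  have hD' : discr ((5 / 7 : ℝ) • S 0) < 0 := by
    rw [discr_smul]
    have : (0 : ℝ) < (5 / 7 : ℝ) ^ 6 := by positivity
    nlinarith
  exact hsol.time_lt_of_discr_neg htr' hD'

end Summit.NavierStokesRegularity.RungBlowupCofinalOddCellGerm
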